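import Mathlib

/-!
# Hodge-locus census — the codimension bookkeeping of the FERMAT-POINT STRUCTURE record (def-free helper of `stmt-HodgeConjecture-16267`)

Cell record `og81/FERMAT-POINT-STRUCTURE-g30.md` (pub-hlocus, lead gen 30), COROLLARY 5 (b) and §5: at the Fermat pair of type
`[4,4,2^{k-4}]` in the Fermat quartic `(2k-2)`-fold the special Hodge locus `V_{-1}` is smooth of codimension `c_N(k) - 1`, where
`c_N(k) = 2·C(k+3,4) - C(k+1,4) - [(k-2)(k+2) + 4k]` is the codimension of the pair locus (THEOREM 1 (ii) of
`og81/FERMAT-PAIRS-ALL-DEGREES-g29.md` at `d = 4`, `m = k - 3`), and the expected codimension of Kloosterman's family of quartics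
containing a complete intersection `Y` of type `(2,2,1^{k-2})` together with the pencil of such `Y` on `X ∩ ⟨Y⟩` [arXiv:2312.12363,
Prop. 6.1] is `h_Y(4) - dim{Y} + 1 = [C(k+5,4) - 2·C(k+3,2) + 1] - [(k+2)(k-2) + 2·(C(k+3,2) - 2)] + 1`.
The record's consistency remark (§5) is the equality of the second number with the first minus one, for EVERY `k ≥ 4`;
`codim_remark.py` checked it for `k = 4..60` by four evaluations.  Here it is kernel-checked for all `k ≥ 4` (over `ℤ`, so that every
subtraction is the honest one), from the closed forms `24·C(n+3,4) = (n+3)(n+2)(n+1)n` and `2·C(n+1,2) = (n+1)n`.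
Values: `c_N = 37, 84, 161, 277, 442` and `36, 83, 160, 276, 441` for `k = 4..8` (`decide`).
Also recorded (`decide`): the regular-pencil numerology of the SEMISIMPLICITY LEMMA — at `k₀` one maximal minor certifies all three
special eigenvalues (`c_N = 2g + 1`: `(37, 18)` for `d = 4, k₀ = 4`; `(39, 19)` for `d = 3, k₀ = 6`), one step up it cannot
(`84 > 2·39 + 1`, `66 > 2·31 + 1`, `102 > 2·46 + 1`), which is why the lemma carries per-eigenvalue row sets beyond `k₀`.

certified instances and evidence bearing on the general Hodge conjecture; no claim.
-/

namespace Summit.HodgeConjecture.HodgeConjecture.HodgeLocus.Census.FermatPointCodim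

/-- `2·C(n+1, 2) = (n+1)·n`. -/
theorem two_mul_choose_two (n : ℕ) : 2 * (n + 1).choose 2 = (n + 1) * n := by
  induction n with
  | zero => decide
  | succ n ih =>
      rw [Nat.choose_succ_succ' (n + 1) 1, Nat.choose_one_right, mul_add, ih]
      ring

/-- `6·C(n+2, 3) = (n+2)(n+1)n`. -/
theorem six_mul_choose_three (n : ℕ) : 6 * (n + 2).choose 3 = (n + 2) * (n + 1) * n := by
  induction n with
  | zero => decide
  | succ n ih =>
      have h2 := two_mul_choose_two (n + 1)
      rw [show n + 1 + 2 = (n + 2) + 1 by omega, Nat.choose_succ_succ' (n + 2) 2, mul_add, ih]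
      rw [show n + 1 + 1 = n + 2 by omega] at h2
      nlinarith [h2]

/-- `24·C(n+3, 4) = (n+3)(n+2)(n+1)n`. -/
theorem twentyfour_mul_choose_four (n : ℕ) : 24 * (n + 3).choose 4 = (n + 3) * (n + 2) * (n + 1) * n := by
  induction n with
  | zero => decide
  | succ n ih =>
      have h3 := six_mul_choose_three (n + 1)
      rw [show n + 1 + 3 = (n + 3) + 1 by omega, Nat.choose_succ_succ' (n + 3) 3, mul_add, ih]
      rw [show n + 1 + 2 = n + 3 by omega, show n + 1 + 1 = n + 2 by omega] at h3
      nlinarith [h3]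

/-- The consistency remark of `FERMAT-POINT-STRUCTURE-g30` §5, written `k = n + 4`: Kloosterman-family expected codimension
`[C(k+5,4) - 2·C(k+3,2) + 1] - [(k+2)(k-2) + 2·(C(k+3,2) - 2)] + 1` equals `c_N(k) - 1`, `c_N(k) = 2·C(k+3,4) - C(k+1,4) - [(k-2)(k+2) + 4k]`
(THEOREM 1 (ii), `d = 4`, `m = k - 3`); all subtractions in `ℤ`.  (Def-free: both sides are written out.) -/
theorem kloostermanFamilyCodim_eq_cN_sub_one_aux (n : ℕ) :
    ((((n + 4 + 5).choose 4 : ℕ) : ℤ) - 2 * ((n + 4 + 3).choose 2 : ℕ) + 1)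
        - (((n + 4 : ℕ) : ℤ) + 2) * (((n + 4 : ℕ) : ℤ) - 2) - 2 * ((((n + 4 + 3).choose 2 : ℕ) : ℤ) - 2) + 1
      = (2 * ((((n + 4 + 3).choose 4 : ℕ)) : ℤ) - ((n + 4 + 1).choose 4 : ℕ)
          - ((((n + 4 : ℕ) : ℤ) - 2) * (((n + 4 : ℕ) : ℤ) + 2) + 4 * ((n + 4 : ℕ) : ℤ))) - 1 := by
  -- the four binomials that occur: C(n+9,4), C(n+7,4), C(n+5,4), C(n+7,2)
  have hA := twentyfour_mul_choose_four (n + 6)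
  rw [show n + 6 + 3 = n + 9 by omega, show n + 6 + 2 = n + 8 by omega, show n + 6 + 1 = n + 7 by omega] at hA
  have hB := twentyfour_mul_choose_four (n + 4)
  rw [show n + 4 + 3 = n + 7 by omega, show n + 4 + 2 = n + 6 by omega, show n + 4 + 1 = n + 5 by omega] at hB
  have hC := twentyfour_mul_choose_four (n + 2)
  rw [show n + 2 + 3 = n + 5 by omega, show n + 2 + 2 = n + 4 by omega, show n + 2 + 1 = n + 3 by omega] at hC
  have hQ := two_mul_choose_two (n + 6)
  rw [show n + 6 + 1 = n + 7 by omega] at hQ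
  have hAq : (24 : ℚ) * ((n + 9).choose 4 : ℕ) = (n + 9) * (n + 8) * (n + 7) * (n + 6) := by exact_mod_cast hA
  have hBq : (24 : ℚ) * ((n + 7).choose 4 : ℕ) = (n + 7) * (n + 6) * (n + 5) * (n + 4) := by exact_mod_cast hB
  have hCq : (24 : ℚ) * ((n + 5).choose 4 : ℕ) = (n + 5) * (n + 4) * (n + 3) * (n + 2) := by exact_mod_cast hC
  have hQq : (2 : ℚ) * ((n + 7).choose 2 : ℕ) = (n + 7) * (n + 6) := by exact_mod_cast hQ
  rw [show n + 4 + 5 = n + 9 by omega, show n + 4 + 3 = n + 7 by omega, show n + 4 + 1 = n + 5 by omega]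
  have key : (((((n + 9).choose 4 : ℕ) : ℤ) - 2 * ((n + 7).choose 2 : ℕ) + 1
        - (((n + 4 : ℕ) : ℤ) + 2) * (((n + 4 : ℕ) : ℤ) - 2) - 2 * ((((n + 7).choose 2 : ℕ) : ℤ) - 2) + 1 : ℤ) : ℚ)
      = (((2 * ((((n + 7).choose 4 : ℕ)) : ℤ) - ((n + 5).choose 4 : ℕ)
          - ((((n + 4 : ℕ) : ℤ) - 2) * (((n + 4 : ℕ) : ℤ) + 2) + 4 * ((n + 4 : ℕ) : ℤ))) - 1 : ℤ) : ℚ) := by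
    push_cast
    linear_combination (1 / 24 : ℚ) * hAq - (1 / 12 : ℚ) * hBq + (1 / 24 : ℚ) * hCq - (2 : ℚ) * hQq
  exact_mod_cast key

/-- The same for every `k ≥ 4` in the record's variable `k`. -/
theorem kloostermanFamilyCodim_eq_cN_sub_one (k : ℕ) (hk : 4 ≤ k) :
    ((((k + 5).choose 4 : ℕ) : ℤ) - 2 * ((k + 3).choose 2 : ℕ) + 1)
        - (((k : ℕ) : ℤ) + 2) * (((k : ℕ) : ℤ) - 2) - 2 * ((((k + 3).choose 2 : ℕ) : ℤ) - 2) + 1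
      = (2 * ((((k + 3).choose 4 : ℕ)) : ℤ) - ((k + 1).choose 4 : ℕ)
          - ((((k : ℕ) : ℤ) - 2) * (((k : ℕ) : ℤ) + 2) + 4 * ((k : ℕ) : ℤ))) - 1 := by
  obtain ⟨n, rfl⟩ : ∃ n, k = n + 4 := ⟨k - 4, by omega⟩
  exact kloostermanFamilyCodim_eq_cN_sub_one_aux n

/-- Values `k = 4..8`: `c_N = 37, 84, 161, 277, 442` (pair-locus codimension, census cells (6,4,1), (8,4,2), (10,4,3), (12,4,4), (14,4,5))
and the family codimension `36, 83, 160, 276, 441`. -/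
theorem values_k4_to_k8 :
    (2 * (Nat.choose 7 4 : ℤ) - (Nat.choose 5 4) - ((4 - 2) * (4 + 2) + 4 * 4) = 37 ∧
      2 * (Nat.choose 8 4 : ℤ) - (Nat.choose 6 4) - ((5 - 2) * (5 + 2) + 4 * 5) = 84 ∧
      2 * (Nat.choose 9 4 : ℤ) - (Nat.choose 7 4) - ((6 - 2) * (6 + 2) + 4 * 6) = 161 ∧
      2 * (Nat.choose 10 4 : ℤ) - (Nat.choose 8 4) - ((7 - 2) * (7 + 2) + 4 * 7) = 277 ∧
      2 * (Nat.choose 11 4 : ℤ) - (Nat.choose 9 4) - ((8 - 2) * (8 + 2) + 4 * 8) = 442) ∧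
    ((Nat.choose 9 4 : ℤ) - 2 * (Nat.choose 7 2) + 1 - ((4 + 2) * (4 - 2) + 2 * ((Nat.choose 7 2 : ℤ) - 2)) + 1 = 36 ∧
      (Nat.choose 10 4 : ℤ) - 2 * (Nat.choose 8 2) + 1 - ((5 + 2) * (5 - 2) + 2 * ((Nat.choose 8 2 : ℤ) - 2)) + 1 = 83 ∧
      (Nat.choose 11 4 : ℤ) - 2 * (Nat.choose 9 2) + 1 - ((6 + 2) * (6 - 2) + 2 * ((Nat.choose 9 2 : ℤ) - 2)) + 1 = 160 ∧
      (Nat.choose 12 4 : ℤ) - 2 * (Nat.choose 10 2) + 1 - ((7 + 2) * (7 - 2) + 2 * ((Nat.choose 10 2 : ℤ) - 2)) + 1 = 276 ∧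
      (Nat.choose 13 4 : ℤ) - 2 * (Nat.choose 11 2) + 1 - ((8 + 2) * (8 - 2) + 2 * ((Nat.choose 11 2 : ℤ) - 2)) + 1 = 441) := by
  decide

/-- Regular-pencil numerology of the SEMISIMPLICITY LEMMA: at `k₀` one maximal minor suffices (`c_N = 2g + 1`), one step up it cannot. -/
theorem regular_pencil_numerology :
    (37 = 2 * 18 + 1 ∧ 39 = 2 * 19 + 1) ∧ (2 * 39 + 1 < 84 ∧ 2 * 31 + 1 < 66 ∧ 2 * 46 + 1 < 102) := by decide

end Summit.HodgeConjecture.HodgeConjecture.HodgeLocus.Census.FermatPointCodim
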